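import Literature.MathematicalPhysics.QuantumFieldTheory.GammaHermiticity
import Literature.LinearAlgebra.Matrix.PfaffianCharpoly
import HarnessLib

/-!
# Γ-Hermiticity, II: the Pfaffian `Pf(B D)` of a Γ-Hermitian operator is real; its sign

Sequel of `GammaHermiticity.lean` (whose `det_sub_scalar_nonneg` ASSUMES that every eigenvalue has
even algebraic multiplicity, and whose `im_eq_zero_of_sq_eq_ofReal` types the last step "for an
arbitrary `z` standing for the Pfaffian") and of `Literature/LinearAlgebra/Matrix/PfaffianCharpoly.lean`
(the Pfaffian characteristic polynomial `P(X) = Pf(B D − X B)`, `P² = det B · χ_D`, even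
multiplicities, `Pf(B D) = Pf(B) ∏ λ_α^{m_α}`).  Here the two halves are joined, and the second half
of Lucini–Patella–Ramos–Tantalo 2016, App. D "Anatomy of the sign problem", becomes a theorem about
an arbitrary Γ-Hermitian matrix `D` (`Dᴴ = Γ D Γ⁻¹`) and an alternating `B` with `B D` alternating
and `det B = 1` (in the application `B = C ⊗ 1` is the charge-conjugation matrix and `D = D_𝒥` the
C⋆-periodic Wilson–Dirac operator; `Literature/MathematicalPhysics/QuantumLattice/CPeriodicPfaffianSign.lean`):

* `det_sub_scalar_nonneg_of_alternating` — "Since all multiplicities are even, the determinant is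
  positive if `s` is real": `Det(D − s) ≥ 0` for real `s`, the evenness now PROVED
  (`even_rootMultiplicity_charpoly`) instead of assumed;
* `pfaffian_sq_eq_det_sub` — `[Pf(B(D − s))]² = det B · Det(D − s)`;
* `im_pfaffian_mul_sub_smul_eq_zero`, **`im_pfaffian_mul_eq_zero`** — "and consequently the
  Pfaffian is real": `Pf(B(D − s)) ∈ ℝ` for every real `s`, in particular `Pf(B D) ∈ ℝ`;
* `pfaffianCharpoly_map_conj`, `roots_pfaffianCharpoly_map_conj` — `P` has real coefficients, so
  its roots (the eigenvalues with half multiplicity `m_α`) are real or come in conjugate pairs;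
* **`pfaffian_mul_eq_prod_eigenvalues`** — the printed formula
  `Pf_K C D_𝒥 = ∏_{Im λ_α = 0} λ_α^{m_α} ∏_{Im λ_α > 0} |λ_α^{m_α}|²`, with the `s → ∞`
  normalisation `Pf(B) = ±1` (`pfaffian_eq_one_or_eq_neg_one`) kept as an explicit factor;
* **`pfaffian_mul_sign_of_no_negative_eigenvalue`** (and the strict form) — "clearly the Pfaffian
  is negative only if the Dirac operator `D_𝒥` has some negative eigenvalues": if no REAL eigenvalue
  of `D` is negative then `Pf(B D) = Pf(B) · r` with `r ≥ 0`.

## References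

* B. Lucini, A. Patella, A. Ramos, N. Tantalo, JHEP **02** (2016) 076, arXiv:1509.01636, App. D
  "Anatomy of the sign problem" [corpus:paper-arxiv-1509.01636 p0031 L85–L112]. [LuciniEtAl2016]
* I. Montvay, Int. J. Mod. Phys. A **17** (2002) 2377, hep-lat/0112007, eqs. (44)–(47): "`det(Q) =
  det(M) = [Pf(M)]²` … the Pfaffian `Pf(M)` has to be real – but it can have any sign". [Montvay2002]
-/

noncomputable section

namespace Literature.MathematicalPhysics.QuantumFieldTheory.GammaHermiticity

open Matrix Polynomial Literature.LinearAlgebra.Matrix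
open scoped ComplexConjugate

/-! ## Ring-level identities: `[Pf(B(D − s))]² = det B · Det(s − D)` -/

section CommRing

variable {R : Type*} [CommRing R] {n : ℕ} (B D : Matrix (Fin n) (Fin n) R)

/-- **`[Pf_K C(D_𝒥 − s)]² = Det_K C · Det_K(s − D_𝒥)`** pointwise: evaluating `P² = det B · χ_D`
(`pfaffianCharpoly_sq`) at `s`. [cite: LuciniEtAl2016, App. D (Det_K(D_𝒥 − s) = [Pf_K C(D_𝒥 − s)]²)] -/
theorem pfaffian_sq_eq_det_mul_det_scalar_sub (hB : Bᵀ = -B) (hBd : ∀ i, B i i = 0)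
    (hM : (B * D)ᵀ = -(B * D)) (hMd : ∀ i, (B * D) i i = 0) (s : R) :
    pfaffian (B * D - s • B) ^ 2 = B.det * (Matrix.scalar (Fin n) s - D).det := by
  have h := congrArg (Polynomial.eval s) (pfaffianCharpoly_sq B D hB hBd hM hMd)
  rwa [eval_pow, eval_pfaffianCharpoly, eval_mul, eval_C, Matrix.eval_charpoly] at h

end CommRing

/-! ## Over `ℂ`: alternating matrices have zero diagonal -/

section Complex

variable {n : ℕ}

/-- Over `ℂ` an antisymmetric matrix has zero diagonal. [folklore] -/
private theorem apply_self_eq_zero_of_transpose_eq_neg (M : Matrix (Fin n) (Fin n) ℂ)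
    (hM : Mᵀ = -M) (i : Fin n) : M i i = 0 := by
  have h := congrFun (congrFun hM i) i
  rw [transpose_apply, neg_apply] at h
  have h2 : (2 : ℂ) * M i i = 0 := by linear_combination h
  simpa using h2

variable {Γ : Matrix (Fin n) (Fin n) ℂ} (B D : Matrix (Fin n) (Fin n) ℂ)

/-- **Even multiplicities, discharged.**  For a Γ-Hermitian `D` (`Dᴴ = Γ D Γ⁻¹`) admitting an
invertible alternating `B` with `B D` alternating, `Det(s·1 − D) = χ_D(s)` is a non-negative real
for every real `s`: the hypothesis "all algebraic multiplicities are even" of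
`det_scalar_sub_nonneg` HOLDS, by `even_rootMultiplicity_charpoly` (`χ_D · det B = P²`).
"Since all multiplicities are even, the determinant is positive if `s` is real."
[cite: LuciniEtAl2016, App. D (determinant positive for real s)] -/
theorem det_scalar_sub_nonneg_of_alternating (hΓ : IsUnit Γ.det) (h : Dᴴ = Γ * D * Γ⁻¹)
    (hB : Bᵀ = -B) (hM : (B * D)ᵀ = -(B * D)) (hdet : B.det ≠ 0) (s : ℝ) :
    ∃ r : ℝ, 0 ≤ r ∧ (Matrix.scalar (Fin n) (s : ℂ) - D).det = r :=
  det_scalar_sub_nonneg hΓ h (even_rootMultiplicity_charpoly B D hB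
    (apply_self_eq_zero_of_transpose_eq_neg B hB) hM
    (apply_self_eq_zero_of_transpose_eq_neg (B * D) hM) hdet) s

/-- The same for `Det(D − s·1)` (even size). [cite: LuciniEtAl2016, App. D (determinant positive for real s)] -/
theorem det_sub_scalar_nonneg_of_alternating (hΓ : IsUnit Γ.det) (h : Dᴴ = Γ * D * Γ⁻¹)
    (hB : Bᵀ = -B) (hM : (B * D)ᵀ = -(B * D)) (hdet : B.det ≠ 0) (s : ℝ) :
    ∃ r : ℝ, 0 ≤ r ∧ (D - Matrix.scalar (Fin n) (s : ℂ)).det = r :=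
  det_sub_scalar_nonneg hΓ h (even_rootMultiplicity_charpoly B D hB
    (apply_self_eq_zero_of_transpose_eq_neg B hB) hM
    (apply_self_eq_zero_of_transpose_eq_neg (B * D) hM) hdet) s

/-- In particular `Det D ≥ 0` (`s = 0`): with C⋆ boundary conditions the one-flavour Wilson
determinant `Det_K D_𝒥 = (Pf_K C D_𝒥)²` is non-negative. [cite: LuciniEtAl2016, App. D (determinant positive for real s)] -/
theorem det_nonneg_of_alternating (hΓ : IsUnit Γ.det) (h : Dᴴ = Γ * D * Γ⁻¹)
    (hB : Bᵀ = -B) (hM : (B * D)ᵀ = -(B * D)) (hdet : B.det ≠ 0) :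
    ∃ r : ℝ, 0 ≤ r ∧ D.det = r := by
  simpa using det_sub_scalar_nonneg_of_alternating B D hΓ h hB hM hdet 0

/-- `[Pf(B(D − s))]² = det B · Det(s − D)` over `ℂ` (zero diagonals automatic).
[cite: LuciniEtAl2016, App. D (Det_K(D_𝒥 − s) = [Pf_K C(D_𝒥 − s)]²)] -/
theorem pfaffian_sq_eq_det_sub (hB : Bᵀ = -B) (hM : (B * D)ᵀ = -(B * D)) (s : ℂ) :
    pfaffian (B * D - s • B) ^ 2 = B.det * (Matrix.scalar (Fin n) s - D).det :=
  pfaffian_sq_eq_det_mul_det_scalar_sub B D hB (apply_self_eq_zero_of_transpose_eq_neg B hB) hM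
    (apply_self_eq_zero_of_transpose_eq_neg (B * D) hM) s

/-! ## The Pfaffian is real -/

/-- **`Pf(B(D − s))` is real for real `s`** (`det B = 1`): its square is `Det(s − D) ≥ 0`
(`det_scalar_sub_nonneg_of_alternating`), and `z² = r ≥ 0 ⇒ z ∈ ℝ`
(`im_eq_zero_of_sq_eq_ofReal`).  "Since all multiplicities are even, the determinant is positive
if `s` is real, and consequently the Pfaffian is real." [cite: LuciniEtAl2016, App. D (the Pfaffian itself is real)] -/
theorem im_pfaffian_mul_sub_smul_eq_zero (hΓ : IsUnit Γ.det) (h : Dᴴ = Γ * D * Γ⁻¹)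
    (hB : Bᵀ = -B) (hM : (B * D)ᵀ = -(B * D)) (hB1 : B.det = 1) (s : ℝ) :
    (pfaffian (B * D - (s : ℂ) • B)).im = 0 := by
  obtain ⟨r, hr, hdet⟩ := det_scalar_sub_nonneg_of_alternating B D hΓ h hB hM (by simp [hB1]) s
  refine im_eq_zero_of_sq_eq_ofReal hr ?_
  rw [pfaffian_sq_eq_det_sub B D hB hM, hB1, one_mul, hdet]

/-- **"The Pfaffian itself is real"**: `Im Pf(B D) = 0` for a Γ-Hermitian `D` and an alternating
`B` with `B D` alternating and `det B = 1` (Lucini–Patella–Ramos–Tantalo 2016, App. D; Montvay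
2002 after (47): "the Pfaffian `Pf(M)` has to be real – but it can have any sign").
[cite: LuciniEtAl2016, App. D (the Pfaffian itself is real)] -/
theorem im_pfaffian_mul_eq_zero (hΓ : IsUnit Γ.det) (h : Dᴴ = Γ * D * Γ⁻¹)
    (hB : Bᵀ = -B) (hM : (B * D)ᵀ = -(B * D)) (hB1 : B.det = 1) :
    (pfaffian (B * D)).im = 0 := by
  simpa using im_pfaffian_mul_sub_smul_eq_zero B D hΓ h hB hM hB1 0

/-- Real form: `Pf(B D) = Re Pf(B D)`. [cite: LuciniEtAl2016, App. D (the Pfaffian itself is real)] -/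
theorem pfaffian_mul_eq_ofReal_re (hΓ : IsUnit Γ.det) (h : Dᴴ = Γ * D * Γ⁻¹)
    (hB : Bᵀ = -B) (hM : (B * D)ᵀ = -(B * D)) (hB1 : B.det = 1) :
    pfaffian (B * D) = ((pfaffian (B * D)).re : ℂ) :=
  Complex.ext rfl (by rw [im_pfaffian_mul_eq_zero B D hΓ h hB hM hB1, Complex.ofReal_im])

/-- The reference sign: `(Pf B)² = det B = 1`, so `Pf B = ±1` (the `s → ∞` normalisation of
Lucini et al., which the printed formula sets to `1`). [cite: LuciniEtAl2016, App. D (normalization from the s → ∞ limit)] -/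
theorem pfaffian_eq_one_or_eq_neg_one (hB : Bᵀ = -B) (hB1 : B.det = 1) :
    pfaffian B = 1 ∨ pfaffian B = -1 := by
  have hsq : pfaffian B * pfaffian B = 1 := by
    rw [← sq, ← det_eq_pfaffian_sq B hB (apply_self_eq_zero_of_transpose_eq_neg B hB), hB1]
  exact mul_self_eq_one_iff.mp hsq

/-! ## `P` has real coefficients; conjugate pairing of its roots -/

/-- **The Pfaffian characteristic polynomial has real coefficients**: `conj P = P`, because `P(s)`
is real for every real `s` (`im_pfaffian_mul_sub_smul_eq_zero`) and a polynomial vanishing on `ℝ`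
vanishes. [cite: LuciniEtAl2016, App. D (the Pfaffian itself is real)] -/
theorem pfaffianCharpoly_map_conj (hΓ : IsUnit Γ.det) (h : Dᴴ = Γ * D * Γ⁻¹)
    (hB : Bᵀ = -B) (hM : (B * D)ᵀ = -(B * D)) (hB1 : B.det = 1) :
    (pfaffianCharpoly B D).map (starRingEnd ℂ) = pfaffianCharpoly B D := by
  set P := pfaffianCharpoly B D
  rw [← sub_eq_zero]
  apply Polynomial.eq_zero_of_infinite_isRoot
  refine Set.Infinite.mono ?_ (Set.infinite_range_of_injective Complex.ofReal_injective)
  rintro _ ⟨s, rfl⟩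
  have hreal : conj (P.eval (s : ℂ)) = P.eval (s : ℂ) := by
    rw [eval_pfaffianCharpoly]
    exact Complex.conj_eq_iff_im.mpr (im_pfaffian_mul_sub_smul_eq_zero B D hΓ h hB hM hB1 s)
  have hev : (P.map (starRingEnd ℂ)).eval (s : ℂ) = conj (P.eval (s : ℂ)) := by
    have := Polynomial.eval₂_hom (starRingEnd ℂ) (s : ℂ) (p := P)
    rw [Complex.conj_ofReal, ← Polynomial.eval_map] at this
    exact this
  simp only [Set.mem_setOf_eq, IsRoot.def, eval_sub, hev, hreal, sub_self]

/-- The roots of `P` — the eigenvalues of `D` with half multiplicity `m_α` — form a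
conjugation-invariant multiset: "either the eigenvalues of `D_𝒥` are real or they appear in pairs
of complex conjugates", with `m_{conj λ} = m_λ`. [cite: LuciniEtAl2016, App. D (eigenvalues real or in conjugate pairs)] -/
theorem roots_pfaffianCharpoly_map_conj (hΓ : IsUnit Γ.det) (h : Dᴴ = Γ * D * Γ⁻¹)
    (hB : Bᵀ = -B) (hM : (B * D)ᵀ = -(B * D)) (hB1 : B.det = 1) :
    (pfaffianCharpoly B D).roots.map (starRingEnd ℂ) = (pfaffianCharpoly B D).roots := by
  have hsplit : (pfaffianCharpoly B D).Splits := IsAlgClosed.splits _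
  rw [Polynomial.roots_map_of_injective_of_card_eq_natDegree (starRingEnd ℂ).injective
    (Polynomial.splits_iff_card_roots.mp hsplit), pfaffianCharpoly_map_conj B D hΓ h hB hM hB1]

/-! ## The product formula and the sign -/

/-- Pairing the conjugate roots: the roots with negative imaginary part are the conjugates of those
with positive imaginary part. [folklore] -/
private theorem filter_im_neg_eq_map_conj (t : Multiset ℂ) (ht : t.map (starRingEnd ℂ) = t) :
    t.filter (fun z => z.im < 0) = (t.filter (fun z => 0 < z.im)).map (starRingEnd ℂ) := by
  conv_lhs => rw [← ht]
  rw [Multiset.filter_map]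
  congr 1
  exact Multiset.filter_congr fun z _ => by simp [Complex.conj_im]

/-- Splitting a conjugation-invariant multiset product into real roots and conjugate pairs:
`∏ t = ∏_{Im z = 0} z · ∏_{Im z > 0} |z|²`. [folklore] -/
private theorem prod_eq_prod_real_mul_prod_normSq (t : Multiset ℂ) (ht : t.map (starRingEnd ℂ) = t) :
    t.prod = (t.filter (fun z => z.im = 0)).prod *
      ((t.filter (fun z => 0 < z.im)).map (fun z => (Complex.normSq z : ℂ))).prod := by
  have hsplit : t = t.filter (fun z => z.im = 0) + (t.filter (fun z => 0 < z.im) +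
      t.filter (fun z => z.im < 0)) := by
    conv_lhs => rw [← Multiset.filter_add_not (fun z : ℂ => z.im = 0) t]
    congr 1
    rw [← Multiset.filter_add_not (fun z : ℂ => 0 < z.im) (t.filter fun z => ¬z.im = 0),
      Multiset.filter_filter, Multiset.filter_filter]
    congr 1
    · exact Multiset.filter_congr fun z _ => ⟨fun hz => hz.1, fun hz => ⟨hz, ne_of_gt hz⟩⟩
    · exact Multiset.filter_congr fun z _ =>
        ⟨fun hz => lt_of_le_of_ne (not_lt.mp hz.1) hz.2, fun hz => ⟨not_lt.mpr hz.le, ne_of_lt hz⟩⟩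
  conv_lhs => rw [hsplit]
  have hns : (t.filter (fun z => 0 < z.im)).map (fun z => (Complex.normSq z : ℂ)) =
      (t.filter (fun z => 0 < z.im)).map (fun z => z * conj z) :=
    Multiset.map_congr rfl fun z _ => (Complex.mul_conj z).symm
  rw [Multiset.prod_add, Multiset.prod_add, filter_im_neg_eq_map_conj t ht, hns, Multiset.prod_map_mul,
    Multiset.map_id']

/-- **The sign formula as printed.**  For a Γ-Hermitian `D` and an alternating `B` with `B D`
alternating and `det B = 1`,
`Pf(B D) = Pf(B) · ∏_{Im λ_α = 0} λ_α^{m_α} · ∏_{Im λ_α > 0} |λ_α^{m_α}|²`,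
the products running over the roots of the Pfaffian characteristic polynomial `P(X) = Pf(BD − XB)`
WITH multiplicity `m_α` — i.e. over the eigenvalues of `D` with half their (even) algebraic
multiplicity — and `Pf(B) = ±1` the `s → ∞` normalisation (printed: `Pf_K C D_𝒥 =
∏_{α | Im λ_α = 0} λ_α^{m_α} ∏_{α | Im λ_α > 0} |λ_α^{m_α}|²`, normalisation `1`).
[cite: LuciniEtAl2016, App. D (eq. for Pf_K C D_𝒥 at s = 0)] -/
theorem pfaffian_mul_eq_prod_eigenvalues (hΓ : IsUnit Γ.det) (h : Dᴴ = Γ * D * Γ⁻¹)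
    (hB : Bᵀ = -B) (hM : (B * D)ᵀ = -(B * D)) (hB1 : B.det = 1) :
    pfaffian (B * D) = pfaffian B *
      (((pfaffianCharpoly B D).roots.filter (fun z => z.im = 0)).prod *
        (((pfaffianCharpoly B D).roots.filter (fun z => 0 < z.im)).map
          (fun z => (Complex.normSq z : ℂ))).prod) := by
  rw [pfaffian_mul_eq_mul_prod_roots B D hB (apply_self_eq_zero_of_transpose_eq_neg B hB) hM
    (apply_self_eq_zero_of_transpose_eq_neg (B * D) hM) (by simp [hB1]),
    prod_eq_prod_real_mul_prod_normSq _ (roots_pfaffianCharpoly_map_conj B D hΓ h hB hM hB1)]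

/-- The roots of `P` are eigenvalues of `D` (roots of `χ_D`). [cite: LuciniEtAl2016, App. D (algebraic multiplicity 2m_α)] -/
theorem mem_roots_charpoly_of_mem_roots_pfaffianCharpoly (hB : Bᵀ = -B) (hM : (B * D)ᵀ = -(B * D))
    (hdet : B.det ≠ 0) {μ : ℂ} (hμ : μ ∈ (pfaffianCharpoly B D).roots) : μ ∈ D.charpoly.roots := by
  rw [roots_charpoly_eq_add B D hB (apply_self_eq_zero_of_transpose_eq_neg B hB) hM
    (apply_self_eq_zero_of_transpose_eq_neg (B * D) hM) hdet]
  exact Multiset.mem_add.mpr (Or.inl hμ)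

/-- Casting a product of reals to `ℂ`. [folklore] -/
private theorem prod_ofReal (s : Multiset ℝ) : (s.map ((↑) : ℝ → ℂ)).prod = ((s.prod : ℝ) : ℂ) :=
  Multiset.induction_on s (by simp) fun a s ih => by simp [ih]

/-- A multiset of REAL complex numbers is the image of its real parts. [folklore] -/
private theorem eq_map_ofReal_map_re (t : Multiset ℂ) (ht : ∀ z ∈ t, z.im = 0) :
    t = (t.map Complex.re).map ((↑) : ℝ → ℂ) := by
  rw [Multiset.map_map]
  conv_lhs => rw [← Multiset.map_id t]
  exact Multiset.map_congr rfl fun z hz => Complex.ext (by simp) (by simp [ht z hz])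

/-- **"Clearly the Pfaffian is negative only if the Dirac operator has some negative
eigenvalues"**: if no REAL eigenvalue of the Γ-Hermitian `D` is negative, then
`Pf(B D) = Pf(B) · r` with `r ≥ 0` — relative to the reference sign `Pf(B) = ±1` the Pfaffian is
non-negative (the conjugate pairs contribute `|λ|² > 0`, the real eigenvalues `λ^{m_α}` with
`λ ≥ 0`). [cite: LuciniEtAl2016, App. D (Pfaffian negative only if negative eigenvalues)] -/
theorem pfaffian_mul_sign_of_no_negative_eigenvalue (hΓ : IsUnit Γ.det) (h : Dᴴ = Γ * D * Γ⁻¹)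
    (hB : Bᵀ = -B) (hM : (B * D)ᵀ = -(B * D)) (hB1 : B.det = 1)
    (hnn : ∀ μ ∈ D.charpoly.roots, μ.im = 0 → 0 ≤ μ.re) :
    ∃ r : ℝ, 0 ≤ r ∧ pfaffian (B * D) = pfaffian B * r := by
  set t := (pfaffianCharpoly B D).roots with htdef
  have hdet : B.det ≠ 0 := by simp [hB1]
  have hreal : ∀ z ∈ t.filter (fun z => z.im = 0), z.im = 0 := fun z hz => (Multiset.mem_filter.mp hz).2
  refine ⟨((t.filter (fun z => z.im = 0)).map Complex.re).prod *
      ((t.filter (fun z => 0 < z.im)).map Complex.normSq).prod, mul_nonneg ?_ ?_, ?_⟩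
  · refine Multiset.prod_nonneg fun x hx => ?_
    obtain ⟨z, hz, rfl⟩ := Multiset.mem_map.mp hx
    obtain ⟨hzt, hzim⟩ := Multiset.mem_filter.mp hz
    exact hnn z (mem_roots_charpoly_of_mem_roots_pfaffianCharpoly B D hB hM hdet hzt) hzim
  · refine Multiset.prod_nonneg fun x hx => ?_
    obtain ⟨z, _, rfl⟩ := Multiset.mem_map.mp hx
    exact Complex.normSq_nonneg z
  · rw [pfaffian_mul_eq_prod_eigenvalues B D hΓ h hB hM hB1]
    congr 1
    push_cast
    rw [← prod_ofReal, ← prod_ofReal, ← eq_map_ofReal_map_re _ hreal, Multiset.map_map]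
    rfl

/-- Strict form: if every REAL eigenvalue of `D` is positive then `Pf(B D) = Pf(B) · r` with `r > 0`
— the Pfaffian has exactly the reference sign (as "in the continuum limit, the real part of the
eigenvalues of the Dirac operator is always positive … therefore the Pfaffian is positive").
[cite: LuciniEtAl2016, App. D (Pfaffian negative only if negative eigenvalues)] -/
theorem pfaffian_mul_sign_of_positive_eigenvalues (hΓ : IsUnit Γ.det) (h : Dᴴ = Γ * D * Γ⁻¹)
    (hB : Bᵀ = -B) (hM : (B * D)ᵀ = -(B * D)) (hB1 : B.det = 1)
    (hpos : ∀ μ ∈ D.charpoly.roots, μ.im = 0 → 0 < μ.re) :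
    ∃ r : ℝ, 0 < r ∧ pfaffian (B * D) = pfaffian B * r := by
  set t := (pfaffianCharpoly B D).roots with htdef
  have hdet : B.det ≠ 0 := by simp [hB1]
  have hreal : ∀ z ∈ t.filter (fun z => z.im = 0), z.im = 0 := fun z hz => (Multiset.mem_filter.mp hz).2
  refine ⟨((t.filter (fun z => z.im = 0)).map Complex.re).prod *
      ((t.filter (fun z => 0 < z.im)).map Complex.normSq).prod, mul_pos ?_ ?_, ?_⟩
  · refine Multiset.prod_pos fun x hx => ?_
    obtain ⟨z, hz, rfl⟩ := Multiset.mem_map.mp hx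
    obtain ⟨hzt, hzim⟩ := Multiset.mem_filter.mp hz
    exact hpos z (mem_roots_charpoly_of_mem_roots_pfaffianCharpoly B D hB hM hdet hzt) hzim
  · refine Multiset.prod_pos fun x hx => ?_
    obtain ⟨z, hz, rfl⟩ := Multiset.mem_map.mp hx
    have hzim : 0 < z.im := (Multiset.mem_filter.mp hz).2
    exact Complex.normSq_pos.mpr fun hz0 => by simp [hz0] at hzim
  · rw [pfaffian_mul_eq_prod_eigenvalues B D hΓ h hB hM hB1]
    congr 1
    push_cast
    rw [← prod_ofReal, ← prod_ofReal, ← eq_map_ofReal_map_re _ hreal, Multiset.map_map]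
    rfl

end Complex

end Literature.MathematicalPhysics.QuantumFieldTheory.GammaHermiticity

end
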